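import Mathlib
import HarnessLib
import Summits.Ventures.LatticeQCDFlow.Scoring.SimultaneousAgreementTwoSigma

/-!
# THE SLOPE `g_q(x) = q φ(q√x)/√x` OF THE ACCEPTANCE MASS: CLOSED FORM, DERIVATIVE, MONOTONICITY,
# AND A LIPSCHITZ BOUND ON `[1/2, ∞)`

HONEST FRAMING: exact (Metropolis-corrected) sampling algorithms for lattice gauge theory;
figures of merit are autocorrelation/cost numbers at stated couplings and volumes; no
continuum-physics claim.

Venture `LatticeQCDFlow` (cell pub-lqcd), topic `Scoring`; FANOUT row 4 (`s0-u1-b`, GEN-33).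
NEW WORK of the cell (elementary calculus), no definition, nothing cited as a fact.

WHY (row 4).  `g_q(x) = q φ(q√x)/√x` is the derivative on `(0, ∞)` of the acceptance mass
`ψ_q(x) = N(0,1)([−q√x, q√x])` (`Scoring/GaussianStudentScaleMixture`), whose expectation at the
mean of `n` squared standard normals is the fixed-count calibration `L_{n+1}(q)`.  A SECOND-ORDER
expansion of `ψ_q` about `1` — hence an `O(1/n)` rate for `N(0,1)([−q,q]) − L_{n+1}(q)`, improving
the `n^{−1/2}` of `Scoring/GaussianStudentCountRate` — needs exactly one analytic input: a
Lipschitz constant for `g_q` on `[1/2, ∞)`.  This Mathlib-level file supplies it: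
`g_q(x) = q(√(2π))⁻¹ e^{−q²x/2} (√x)⁻¹` for `x > 0`, `g_q' = −g_q·(q²/2 + 1/(2x))`, `g_q` is
non-negative and non-increasing on `(0, ∞)`, `|g_q'(x)| ≤ g_q(1/2)(q²/2 + 1)` for `x ≥ 1/2`, and so
`|g_q(x) − g_q(y)| ≤ g_q(1/2)(q²/2 + 1)|x − y|` on `[1/2, ∞)`.

## Content

* `acceptanceSlope_eq` — the closed form on `x > 0`; `acceptanceSlope_nonneg`;
  `acceptanceSlope_antitoneOn` — non-increasing on `(0, ∞)` (`q ≥ 0`).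
* **`hasDerivAt_acceptanceSlope`** — `g_q'(x) = −g_q(x)(q²/2 + 1/(2x))` (`x > 0`).
* `abs_deriv_acceptanceSlope_le` — `|g_q'(x)| ≤ g_q(1/2)(q²/2 + 1)` for `x ≥ 1/2`.
* **`abs_acceptanceSlope_sub_le`** — the Lipschitz bound on `[1/2, ∞)`.

("acceptanceSlope" is a docstring nickname for the expression `q * φ(q√x)/√x`; no definition is
introduced.)  Depends on row 4's BUILT `Scoring/SimultaneousAgreementTwoSigma`
(`gaussianPDFReal_std_eq`) and Mathlib.  [ours] throughout.
-/

open MeasureTheory ProbabilityTheory Filter Topology Finset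

namespace Summit.Ventures.LatticeQCDFlow.Scoring

open Set

section Slope

/-- Closed form: for `x > 0`, `q φ(q√x)/√x = q (√(2π))⁻¹ e^{−q²x/2} (√x)⁻¹`. [ours] -/
theorem acceptanceSlope_eq (q : ℝ) {x : ℝ} (hx : 0 < x) :
    q * gaussianPDFReal 0 1 (q * Real.sqrt x) / Real.sqrt x
      = q * (Real.sqrt (2 * Real.pi))⁻¹ * Real.exp (-(q ^ 2 * x / 2)) * (Real.sqrt x)⁻¹ := by
  rw [CardConsistency.gaussianPDFReal_std_eq, mul_pow, Real.sq_sqrt hx.le, div_eq_mul_inv]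
  ring

/-- `g_q ≥ 0` for `q ≥ 0`. [ours] -/
theorem acceptanceSlope_nonneg {q : ℝ} (hq : 0 ≤ q) (x : ℝ) :
    0 ≤ q * gaussianPDFReal 0 1 (q * Real.sqrt x) / Real.sqrt x :=
  div_nonneg (mul_nonneg hq (gaussianPDFReal_nonneg _ _ _)) (Real.sqrt_nonneg _)

/-- `g_q` is non-increasing on `(0, ∞)` (`q ≥ 0`): both `φ(q√x)` and `1/√x` decrease. [ours] -/
theorem acceptanceSlope_antitoneOn {q : ℝ} (hq : 0 ≤ q) :
    AntitoneOn (fun x : ℝ => q * gaussianPDFReal 0 1 (q * Real.sqrt x) / Real.sqrt x) (Ioi 0) := by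
  intro x hx y hy hxy
  have hsx : 0 < Real.sqrt x := Real.sqrt_pos.2 hx
  have hsy : 0 < Real.sqrt y := Real.sqrt_pos.2 hy
  have hsxy : Real.sqrt x ≤ Real.sqrt y := Real.sqrt_le_sqrt hxy
  have hpdf : gaussianPDFReal 0 1 (q * Real.sqrt y) ≤ gaussianPDFReal 0 1 (q * Real.sqrt x) := by
    rw [CardConsistency.gaussianPDFReal_std_eq, CardConsistency.gaussianPDFReal_std_eq]
    refine mul_le_mul_of_nonneg_left (Real.exp_le_exp.2 ?_) (by positivity)
    have : (q * Real.sqrt x) ^ 2 ≤ (q * Real.sqrt y) ^ 2 := by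
      rw [mul_pow, mul_pow, Real.sq_sqrt hx.le, Real.sq_sqrt hy.le]
      exact mul_le_mul_of_nonneg_left hxy (sq_nonneg q)
    linarith
  simp only
  calc q * gaussianPDFReal 0 1 (q * Real.sqrt y) / Real.sqrt y
      ≤ q * gaussianPDFReal 0 1 (q * Real.sqrt x) / Real.sqrt y :=
        div_le_div_of_nonneg_right (mul_le_mul_of_nonneg_left hpdf hq) hsy.le
    _ ≤ q * gaussianPDFReal 0 1 (q * Real.sqrt x) / Real.sqrt x :=
        div_le_div_of_nonneg_left (mul_nonneg hq (gaussianPDFReal_nonneg _ _ _)) hsx hsxy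

/-- **The derivative of the slope**: for `x > 0`,
`d/dx [q φ(q√x)/√x] = −(q φ(q√x)/√x)·(q²/2 + 1/(2x))`. [ours] -/
theorem hasDerivAt_acceptanceSlope (q : ℝ) {x : ℝ} (hx : 0 < x) :
    HasDerivAt (fun x : ℝ => q * gaussianPDFReal 0 1 (q * Real.sqrt x) / Real.sqrt x)
      (-(q * gaussianPDFReal 0 1 (q * Real.sqrt x) / Real.sqrt x) * (q ^ 2 / 2 + 1 / (2 * x))) x := by
  -- near `x > 0` the function is the closed form
  have heq : (fun y : ℝ => q * gaussianPDFReal 0 1 (q * Real.sqrt y) / Real.sqrt y)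
      =ᶠ[𝓝 x] fun y => q * (Real.sqrt (2 * Real.pi))⁻¹ * Real.exp (-(q ^ 2 * y / 2)) * (Real.sqrt y)⁻¹ := by
    filter_upwards [Ioi_mem_nhds hx] with y hy
    exact acceptanceSlope_eq q hy
  have hsx : 0 < Real.sqrt x := Real.sqrt_pos.2 hx
  -- derivative of the closed form
  have h1 : HasDerivAt (fun y : ℝ => Real.exp (-(q ^ 2 * y / 2)))
      (Real.exp (-(q ^ 2 * x / 2)) * (-(q ^ 2 / 2))) x := by
    have : HasDerivAt (fun y : ℝ => -(q ^ 2 * y / 2)) (-(q ^ 2 / 2)) x := by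
      have h := ((hasDerivAt_id x).const_mul (q ^ 2)).div_const 2
      simp only [mul_one] at h
      exact h.neg
    exact this.exp
  have h2 : HasDerivAt (fun y : ℝ => (Real.sqrt y)⁻¹) (-(1 / (2 * Real.sqrt x)) / (Real.sqrt x) ^ 2) x :=
    (Real.hasDerivAt_sqrt hx.ne').inv hsx.ne'
  have h3 := ((h1.const_mul (q * (Real.sqrt (2 * Real.pi))⁻¹)).mul h2)
  refine (h3.congr_of_eventuallyEq heq).congr_deriv ?_
  rw [acceptanceSlope_eq q hx]
  field_simp
  rw [Real.sq_sqrt hx.le]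
  ring

/-- **Bound on the derivative of the slope on `[1/2, ∞)`**: for `q ≥ 0` and `x ≥ 1/2`,
`|g_q'(x)| ≤ g_q(1/2)·(q²/2 + 1)`. [ours] -/
theorem abs_deriv_acceptanceSlope_le {q : ℝ} (hq : 0 ≤ q) {x : ℝ} (hx : 1 / 2 ≤ x) :
    |-(q * gaussianPDFReal 0 1 (q * Real.sqrt x) / Real.sqrt x) * (q ^ 2 / 2 + 1 / (2 * x))|
      ≤ (q * gaussianPDFReal 0 1 (q * Real.sqrt (1 / 2)) / Real.sqrt (1 / 2)) * (q ^ 2 / 2 + 1) := by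
  have hx0 : 0 < x := lt_of_lt_of_le (by norm_num) hx
  have hg0 : 0 ≤ q * gaussianPDFReal 0 1 (q * Real.sqrt x) / Real.sqrt x := acceptanceSlope_nonneg hq x
  have hfac0 : 0 ≤ q ^ 2 / 2 + 1 / (2 * x) := by positivity
  rw [neg_mul, abs_neg, abs_of_nonneg (mul_nonneg hg0 hfac0)]
  have hmono : q * gaussianPDFReal 0 1 (q * Real.sqrt x) / Real.sqrt x
      ≤ q * gaussianPDFReal 0 1 (q * Real.sqrt (1 / 2)) / Real.sqrt (1 / 2) :=
    acceptanceSlope_antitoneOn hq (by norm_num : (1 / 2 : ℝ) ∈ Set.Ioi 0) hx0 hx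
  have hfac : q ^ 2 / 2 + 1 / (2 * x) ≤ q ^ 2 / 2 + 1 := by
    have : 1 / (2 * x) ≤ 1 := by
      rw [div_le_one (by positivity)]; linarith
    linarith
  exact mul_le_mul hmono hfac hfac0 (acceptanceSlope_nonneg hq _)

/-- **Lipschitz bound for the slope on `[1/2, ∞)`** (`q ≥ 0`):
`|g_q(x) − g_q(y)| ≤ g_q(1/2)(q²/2 + 1)·|x − y|` for `x, y ≥ 1/2`. [ours] -/
theorem abs_acceptanceSlope_sub_le {q : ℝ} (hq : 0 ≤ q) {x y : ℝ} (hx : 1 / 2 ≤ x) (hy : 1 / 2 ≤ y) :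
    |q * gaussianPDFReal 0 1 (q * Real.sqrt x) / Real.sqrt x
        - q * gaussianPDFReal 0 1 (q * Real.sqrt y) / Real.sqrt y|
      ≤ (q * gaussianPDFReal 0 1 (q * Real.sqrt (1 / 2)) / Real.sqrt (1 / 2)) * (q ^ 2 / 2 + 1)
        * |x - y| := by
  have hconv : Convex ℝ (Ici (1 / 2 : ℝ)) := convex_Ici _
  have hderiv : ∀ z ∈ Ici (1 / 2 : ℝ), HasDerivWithinAt
      (fun z : ℝ => q * gaussianPDFReal 0 1 (q * Real.sqrt z) / Real.sqrt z)
      (-(q * gaussianPDFReal 0 1 (q * Real.sqrt z) / Real.sqrt z) * (q ^ 2 / 2 + 1 / (2 * z)))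
      (Ici (1 / 2 : ℝ)) z := fun z hz =>
    (hasDerivAt_acceptanceSlope q (lt_of_lt_of_le (by norm_num) hz)).hasDerivWithinAt
  have hbound : ∀ z ∈ Ici (1 / 2 : ℝ),
      ‖-(q * gaussianPDFReal 0 1 (q * Real.sqrt z) / Real.sqrt z) * (q ^ 2 / 2 + 1 / (2 * z))‖
        ≤ (q * gaussianPDFReal 0 1 (q * Real.sqrt (1 / 2)) / Real.sqrt (1 / 2)) * (q ^ 2 / 2 + 1) :=
    fun z hz => by rw [Real.norm_eq_abs]; exact abs_deriv_acceptanceSlope_le hq hz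
  have h := hconv.norm_image_sub_le_of_norm_hasDerivWithin_le hderiv hbound hy hx
  rw [Real.norm_eq_abs, Real.norm_eq_abs] at h
  exact h

end Slope

end Summit.Ventures.LatticeQCDFlow.Scoring
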